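import Mathlib
import HarnessLib
import Literature.Analysis.FluidPDE.TypeIAncientMild
import Summits.NavierStokesRegularity.NavierStokesRegularity.Theorems.SymmetryModuliCountFarPastLedgerMeanDisplacementTools

/-!
# Route SymmetryModuliCount — far-past ledger: the bump-averaged mean displacement vanishes

Theorems file serving the crux item stmt-NavierStokesRegularity-14060
(`Summit.NavierStokesRegularity.NavierStokesRegularity.Theses.SymmetryModuliCount.FarPastLedger`),
line `uloc-gronwall-transplant`, registered stub MD `stub_fplMeanDisplacement` (the one place of
the line where the Oseen integral identity of the class `IsTypeIAncientMild` is consumed):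

* for `u ∈ A_C` (`IsTypeIAncientMild C u`), `t₁ < t₂ < 0` and the Mathlib bump `θ` (`= 1` on
  `B̄₁`, supported in `B₂`), `r⁻³ ∫ θ(x/r) (u(t₂,x) − u(t₁,x)) dx → 0` as `r → ∞`.

## Proof

Pair the pointwise identity `u(t₂) − u(t₁) = (e^{δΔ}u(t₁) − u(t₁)) − B¹_{t₁}(u,u)(t₂)`,
`δ = t₂ − t₁` (`IsTypeIAncientMild.mild_eq_heatExtension`) with the test field
`w_r = θ_r • v`, `θ_r = θ(·/r)`, for a fixed vector `v`.

* *Caloric part.* By the symmetry of the heat pairing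
  (`integral_inner_heatExtension_comm_of_bound`) it is `∫⟪u(t₁), e^{δΔ}w_r − w_r⟫`, and
  `e^{δΔ}w_r(x) − w_r(x) = ∫ G_δ(z)(w_r(x − z) − w_r(x)) dz`; by Tonelli its `L¹` size is at most
  `∫ G_δ(z) ω_r(z) dz` with the `L¹` modulus of continuity `ω_r(z) = ∫|θ_r(y + z) − θ_r(y)| dy`.
* *Duhamel part.* By Fubini (`integral_inner_oseenDuhamel_eq_setIntegral`) it is the space–time
  integral of `Ψ(τ,y) = ∫ θ_r(x)⟪K(t₂ − τ, x − y)[u, u], v⟫ dx`; the Oseen kernel has **zero mean**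
  (`integral_oseenKernel_eq_zero`), so `θ_r(x)` may be replaced by `θ_r(x) − θ_r(y)`, and after the
  substitution `x = y + z` and Tonelli the `y`-integral is again `ω_r(z)`, against the
  Koch–Tataru majorant `C(σ + |z|²)^{-(d+1)/2} M²` (`exists_norm_oseenKernel_le`).
* *The modulus.* `θ_r` is `L/r`-Lipschitz with values in `[0,1]` and the increment
  `y ↦ θ_r(y+z) − θ_r(y)` lives on two balls of radius `2r`, so
  `ω_r(z) ≤ 2|B_{2r}| min(1, L|z|/r)`; using `min(1,a) ≤ a` in the caloric part (first Gaussian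
  moment) and `min(1, a) ≤ a^{1/2}(σ + |z|²)^{1/4}/|z|^{1/2}` in the Duhamel part
  (`∫(σ+|z|²)^{-(d/2+1/4)} = c σ^{-1/4}`, integrable over `σ ∈ (0, δ)`) both parts are
  `O(r^{d − 1/2}) = o(r^d)`.

The analysis is written for any finite-dimensional real inner product space `E` (normalisation
`r^{-dim E}`) and specialised verbatim to `ℝ³` in the registered signature; the `L¹` modulus, the
caloric estimate and the Duhamel slice estimate are the sibling tools file
`SymmetryModuliCountFarPastLedgerMeanDisplacementTools.lean`.

## References

Elementary; the only inputs are the tree's Oseen-kernel facts (Koch–Tataru 2001, (8), (14);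
Koch–Nadirashvili–Seregin–Šverák 2009, §4: `KochTataru*.lean`, `NSBoundedMildOseenDuhamel.lean`,
`KNSSRemark61.lean`) and Gaussian moments (`HeatKernelBoundedData.lean`).
Skeleton: `Cruxes/FarPastLedger/Lines/uloc_gronwall_transplant.lean`, stub MD.
-/

noncomputable section

set_option linter.dupNamespace false -- nested layout Summit.<S>.<Sub>, Sub = S (D-0017)

open MeasureTheory Set Filter Topology Function Metric
open Literature.Analysis.FluidPDE Literature.Analysis.UnboundedOperators
open scoped RealInnerProductSpace ENNReal NNReal

namespace Summit.NavierStokesRegularity.NavierStokesRegularity.Theorems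

variable {E : Type*} [NormedAddCommGroup E] [InnerProductSpace ℝ E] [FiniteDimensional ℝ E]
  [MeasurableSpace E] [BorelSpace E]

/-! ### The rescaled bump `θ(·/r)` -/

omit [MeasurableSpace E] [BorelSpace E] in
/-- The rescaled bump `θ_r = θ(r⁻¹ ·)` (`θ` a smooth bump at `0`, `r > 0`): continuous, compactly
supported in `B(0, r_out r)`, with values in `[0, 1]`, and `L/r`-Lipschitz where `L` is a
Lipschitz constant of `θ`; hence `|θ_r(y + z) − θ_r(y)| ≤ min(1, (L/r)|z|)`. [folklore] -/
theorem fpl_meanDisp_bump_scaled (θ : ContDiffBump (0 : E)) :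
    ∃ L : ℝ, 0 ≤ L ∧ ∀ {r : ℝ}, 0 < r →
      Continuous (fun x => θ (r⁻¹ • x)) ∧ HasCompactSupport (fun x => θ (r⁻¹ • x)) ∧
      support (fun x => θ (r⁻¹ • x)) ⊆ ball 0 (θ.rOut * r) ∧
      (∀ y, |θ (r⁻¹ • y)| ≤ 1) ∧
      (∀ y z, |θ (r⁻¹ • (y + z)) - θ (r⁻¹ • y)| ≤ L / r * ‖z‖) ∧
      (∀ y z, |θ (r⁻¹ • (y + z)) - θ (r⁻¹ • y)| ≤ min 1 (L / r * ‖z‖)) := by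
  obtain ⟨L, hL⟩ := ContDiff.lipschitzWith_of_hasCompactSupport θ.hasCompactSupport
    (θ.contDiff (n := 1)) one_ne_zero
  refine ⟨L, L.coe_nonneg, fun {r} hr => ?_⟩
  have hcont : Continuous (fun x => θ (r⁻¹ • x)) := θ.continuous.comp (continuous_const_smul r⁻¹)
  have hsupp : support (fun x => θ (r⁻¹ • x)) ⊆ ball 0 (θ.rOut * r) := by
    intro x hx
    rw [mem_support] at hx
    have hx' : r⁻¹ • x ∈ ball (0 : E) θ.rOut := by
      rw [← θ.support_eq]
      exact mem_support.2 hx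
    rw [mem_ball_zero_iff, norm_smul, norm_inv, Real.norm_of_nonneg hr.le,
      inv_mul_lt_iff₀ hr] at hx'
    rw [mem_ball_zero_iff, mul_comm]
    exact hx'
  have hlip : ∀ y z, |θ (r⁻¹ • (y + z)) - θ (r⁻¹ • y)| ≤ L / r * ‖z‖ := by
    intro y z
    have h := hL.dist_le_mul (r⁻¹ • (y + z)) (r⁻¹ • y)
    rw [Real.dist_eq, dist_eq_norm, ← smul_sub, add_sub_cancel_left, norm_smul, norm_inv,
      Real.norm_of_nonneg hr.le] at h
    calc |θ (r⁻¹ • (y + z)) - θ (r⁻¹ • y)| ≤ L * (r⁻¹ * ‖z‖) := h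
      _ = L / r * ‖z‖ := by ring
  have hone : ∀ y z, |θ (r⁻¹ • (y + z)) - θ (r⁻¹ • y)| ≤ 1 := fun y z => by
    rw [abs_sub_le_iff]
    constructor <;>
      linarith [θ.nonneg' (r⁻¹ • (y + z)), θ.le_one (x := r⁻¹ • (y + z)), θ.nonneg' (r⁻¹ • y),
        θ.le_one (x := r⁻¹ • y)]
  refine ⟨hcont, ?_, hsupp, fun y => ?_, hlip, fun y z => le_min (hone y z) (hlip y z)⟩
  · exact HasCompactSupport.of_support_subset_isCompact (isCompact_closedBall 0 (θ.rOut * r))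
      (hsupp.trans ball_subset_closedBall)
  · rw [abs_of_nonneg (θ.nonneg' _)]
    exact θ.le_one

/-! ### The Duhamel part: integration in time -/

omit [NormedAddCommGroup E] [InnerProductSpace ℝ E] [FiniteDimensional ℝ E] [MeasurableSpace E]
  [BorelSpace E] in
/-- `σ^{-1/4} ≤ 1 + σ^{-1/2}` for `σ > 0` (split at `σ = 1`). [folklore] -/
theorem fpl_meanDisp_rpow_neg_quarter_le {σ : ℝ} (hσ : 0 < σ) :
    σ ^ (-(1 / 4 : ℝ)) ≤ 1 + σ ^ (-(1 / 2 : ℝ)) := by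
  rcases le_or_gt 1 σ with h | h
  · have : σ ^ (-(1 / 4 : ℝ)) ≤ 1 := Real.rpow_le_one_of_one_le_of_nonpos h (by norm_num)
    linarith [Real.rpow_nonneg hσ.le (-(1 / 2 : ℝ))]
  · have : σ ^ (-(1 / 4 : ℝ)) ≤ σ ^ (-(1 / 2 : ℝ)) :=
      Real.rpow_le_rpow_of_exponent_ge hσ h.le (by norm_num)
    linarith

/-- **Duhamel estimate.** There is `C₁ = C₁(E) > 0` such that for `u ∈ A_C`
(`IsTypeIAncientMild C u`), `t₁ < t₂ < 0`, `g` continuous compactly supported in `B` with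
`|g| ≤ 1` and increments `|g(y + z) − g(y)| ≤ min(1, Λ|z|)`, and a vector `v`:
`|∫⟪B¹_{t₁}(u,u)(t₂), g v⟫| ≤ C₁ (C/√(−t₂))² |v| Λ^{1/2} ((t₂ − t₁) + 2√(t₂ − t₁)) · 2|B|`
(Fubini for the Duhamel term of the bounded field `u` on `(t₁, t₂) × E`,
`integral_inner_oseenDuhamel_eq_setIntegral`, the slice estimate at `σ = t₂ − τ`, and
`σ^{-1/4} ≤ 1 + σ^{-1/2}`, `∫_{t₁}^{t₂}(t₂ − τ)^{-1/2}dτ = 2√(t₂ − t₁)`). [cite: KochNadirashviliSereginSverak2009, §4 p. 8 (the bilinear form B) (arXiv:0709.3599)] -/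
theorem fpl_meanDisp_oseen_le :
    ∃ C₁ : ℝ, 0 < C₁ ∧ ∀ {C : ℝ} {u : ℝ → E → E}, IsTypeIAncientMild C u →
      ∀ {t₁ t₂ : ℝ}, t₁ < t₂ → t₂ < 0 →
      ∀ {g : E → ℝ}, Continuous g → HasCompactSupport g → ∀ {B : Set E}, support g ⊆ B →
      ∀ {Λ : ℝ}, 0 ≤ Λ → (∀ y, |g y| ≤ 1) → (∀ y z, |g (y + z) - g y| ≤ min 1 (Λ * ‖z‖)) →
      ∀ v : E,
      ‖∫ x, ⟪oseenDuhamel 1 t₁ u u t₂ x, g x • v⟫‖ₑ ≤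
        ENNReal.ofReal (C₁ * (C / Real.sqrt (-t₂)) ^ 2 * ‖v‖ * Λ ^ (1 / 2 : ℝ) *
          ((t₂ - t₁) + 2 * Real.sqrt (t₂ - t₁))) * (2 * volume B) := by
  obtain ⟨C₁, hC₁, hS⟩ := fpl_meanDisp_oseen_slice_le (E := E)
  refine ⟨C₁, hC₁, fun {C u} h {t₁ t₂} ht ht₂ {g} hgc hgs {B} hgB {Λ} hΛ hg1 hgΛ v => ?_⟩
  set M : ℝ := C / Real.sqrt (-t₂) with hM
  have hM0 : 0 ≤ M := div_nonneg h.nonneg (Real.sqrt_nonneg _)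
  have huM : ∀ τ ∈ Ioo t₁ t₂, ∀ y, ‖u τ y‖ ≤ M := fun τ hτ y => h.norm_le_of_mem_Ioo ht₂ hτ y
  have hmeas := h.aestronglyMeasurable_uncurry (s := t₁) ht₂.le
  have hwc : Continuous fun x => g x • v := hgc.smul continuous_const
  have hws : HasCompactSupport fun x => g x • v := hgs.smul_right
  obtain ⟨-, heq⟩ := integral_inner_oseenDuhamel_eq_setIntegral one_pos hmeas hmeas hM0 huM huM
    ht le_rfl hwc hws
  rw [heq]
  set K : ℝ := C₁ * M ^ 2 * ‖v‖ * Λ ^ (1 / 2 : ℝ) with hKdef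
  have hK0 : 0 ≤ K := by positivity
  -- the slice bound at `σ = t₂ - τ`
  have hslice : ∀ τ ∈ Ioo t₁ t₂,
      ∫⁻ y, ‖∫ x, ⟪oseenKernel (1 * (t₂ - τ)) (x - y) (u τ y) (u τ y), g x • v⟫‖ₑ ≤
        ENNReal.ofReal K * ENNReal.ofReal (1 + (t₂ - τ) ^ (-(1 / 2 : ℝ))) * (2 * volume B) := by
    intro τ hτ
    have hσ : 0 < t₂ - τ := sub_pos.2 hτ.2
    rw [one_mul]
    refine (hS hσ hM0 (huM τ hτ) hgc hgB hΛ hg1 hgΛ v).trans ?_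
    rw [← ENNReal.ofReal_mul hK0]
    gcongr
    exact fpl_meanDisp_rpow_neg_quarter_le hσ
  have hfm : Measurable fun τ : ℝ => ENNReal.ofReal (1 + (t₂ - τ) ^ (-(1 / 2 : ℝ))) :=
    (measurable_const.add ((measurable_const.sub measurable_id).pow_const _)).ennreal_ofReal
  have hsplit : ∀ τ ∈ Ioo t₁ t₂, ENNReal.ofReal (1 + (t₂ - τ) ^ (-(1 / 2 : ℝ))) =
      1 + ENNReal.ofReal ((t₂ - τ) ^ (-(1 / 2 : ℝ))) := fun τ hτ => by
    rw [ENNReal.ofReal_add zero_le_one (Real.rpow_nonneg (sub_pos.2 hτ.2).le _), ENNReal.ofReal_one]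
  calc ‖∫ p in Ioo t₁ t₂ ×ˢ univ, ∫ x, ⟪oseenKernel (1 * (t₂ - p.1)) (x - p.2) (u p.1 p.2) (u p.1 p.2),
          g x • v⟫ ∂volume‖ₑ
      ≤ ∫⁻ p in Ioo t₁ t₂ ×ˢ univ, ‖∫ x, ⟪oseenKernel (1 * (t₂ - p.1)) (x - p.2) (u p.1 p.2) (u p.1 p.2),
          g x • v⟫‖ₑ := enorm_integral_le_lintegral_enorm _
    _ ≤ ∫⁻ τ in Ioo t₁ t₂, ∫⁻ y, ‖∫ x, ⟪oseenKernel (1 * (t₂ - τ)) (x - y) (u τ y) (u τ y),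
          g x • v⟫‖ₑ := by
        rw [volume_restrict_prod_univ_eq_prod]
        exact lintegral_prod_le _
    _ ≤ ∫⁻ τ in Ioo t₁ t₂, ENNReal.ofReal K * ENNReal.ofReal (1 + (t₂ - τ) ^ (-(1 / 2 : ℝ))) *
          (2 * volume B) := setLIntegral_mono' measurableSet_Ioo hslice
    _ = ENNReal.ofReal K * (∫⁻ τ in Ioo t₁ t₂, ENNReal.ofReal (1 + (t₂ - τ) ^ (-(1 / 2 : ℝ)))) *
          (2 * volume B) := by
        rw [lintegral_mul_const _ (hfm.const_mul _), lintegral_const_mul _ hfm]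
    _ = ENNReal.ofReal K * ENNReal.ofReal ((t₂ - t₁) + 2 * Real.sqrt (t₂ - t₁)) * (2 * volume B) := by
        rw [setLIntegral_congr_fun measurableSet_Ioo hsplit, lintegral_add_left measurable_const,
          setLIntegral_const, Real.volume_Ioo, setLIntegral_Ioo_sub_rpow_neg_half_of_lt ht,
          one_mul, ← ENNReal.ofReal_add (sub_pos.2 ht).le (by positivity)]
    _ = _ := by rw [← ENNReal.ofReal_mul hK0]

/-! ### Assembly -/

/-- **The bump-averaged mean displacement vanishes at large scales** (any finite-dimensional
`E`, normalisation `r^{-dim E}`): for `u ∈ A_C`, `t₁ < t₂ < 0` and a smooth bump `θ` at `0`,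
`r^{-d} ∫ θ(x/r)(u(t₂,x) − u(t₁,x)) dx → 0` as `r → ∞`. Tested against a fixed vector `v` the
average is the caloric part minus the Duhamel part of the module docstring, of sizes
`O(r^{d−1})` and `O(r^{d−1/2})`; conclude coordinatewise in an orthonormal basis. [cite: KochNadirashviliSereginSverak2009, §4 p. 8 and §6 p. 11 (arXiv:0709.3599)] -/
theorem fpl_meanDisp_tendsto {C : ℝ} {u : ℝ → E → E} (h : IsTypeIAncientMild C u)
    (θ : ContDiffBump (0 : E)) {t₁ t₂ : ℝ} (ht : t₁ < t₂) (ht₂ : t₂ < 0) :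
    Tendsto (fun r : ℝ => (r ^ Module.finrank ℝ E)⁻¹ •
      ∫ x, θ (r⁻¹ • x) • (u t₂ x - u t₁ x)) atTop (𝓝 0) := by
  haveI : CompleteSpace E := FiniteDimensional.complete ℝ E
  set d : ℕ := Module.finrank ℝ E with hd
  have ht₁ : t₁ < 0 := ht.trans ht₂
  have hδ : 0 < t₂ - t₁ := sub_pos.2 ht
  set M : ℝ := C / Real.sqrt (-t₂) with hM
  set M₁ : ℝ := C / Real.sqrt (-t₁) with hM₁
  have hM0 : 0 ≤ M := div_nonneg h.nonneg (Real.sqrt_nonneg _)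
  have hM₁0 : 0 ≤ M₁ := div_nonneg h.nonneg (Real.sqrt_nonneg _)
  have huM : ∀ τ ∈ Ioo t₁ t₂, ∀ y, ‖u τ y‖ ≤ M := fun τ hτ y => h.norm_le_of_mem_Ioo ht₂ hτ y
  have hu₁ : ∀ y, ‖u t₁ y‖ ≤ M₁ := fun y => h.norm_le ht₁ y
  have hmeas := h.aestronglyMeasurable_uncurry (s := t₁) ht₂.le
  obtain ⟨L, hL0, hθ⟩ := fpl_meanDisp_bump_scaled θ
  obtain ⟨C₁, hC₁, hJ⟩ := fpl_meanDisp_oseen_le (E := E)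
  obtain ⟨KB, -, hKB⟩ := exists_norm_oseenDuhamel_bounded_le (E := E)
  set V₁ : ℝ := (volume (ball (0 : E) 1)).toReal with hV₁
  set m₁ : ℝ := 2 * (2 : ℝ) ^ ((d : ℝ) / 2) * (t₂ - t₁) ^ (1 / 2 : ℝ) with hm₁
  have hm₁0 : 0 ≤ m₁ := mul_nonneg (by positivity) (Real.rpow_nonneg hδ.le _)
  have hδ2 : 0 ≤ (t₂ - t₁) + 2 * Real.sqrt (t₂ - t₁) := by positivity
  set K₁ : ℝ := M₁ * L * m₁ * (2 * (θ.rOut ^ d * V₁)) with hK₁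
  set K₂ : ℝ := C₁ * M ^ 2 * L ^ (1 / 2 : ℝ) * ((t₂ - t₁) + 2 * Real.sqrt (t₂ - t₁)) *
    (2 * (θ.rOut ^ d * V₁)) with hK₂
  set F : ℝ → E := fun r => ∫ x, θ (r⁻¹ • x) • (u t₂ x - u t₁ x) with hF
  -- the pointwise identity
  have hut : ∀ x, u t₂ x = heatExtension (u t₁) (t₂ - t₁) x - oseenDuhamel 1 t₁ u u t₂ x :=
    fun x => h.mild_eq_heatExtension ht ht₂ x
  -- the scalar claim
  have key : ∀ v : E, Tendsto (fun r : ℝ => (r ^ d)⁻¹ * ⟪v, F r⟫) atTop (𝓝 0) := by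
    intro v
    have hbound : ∀ r : ℝ, 0 < r →
        ‖(r ^ d)⁻¹ * ⟪v, F r⟫‖ ≤ ‖v‖ * (K₁ * r⁻¹ + K₂ * r ^ (-(1 / 2 : ℝ))) := by
      intro r hr0
      obtain ⟨hgc, hgs, hgB, hg1, hgL, hgmin⟩ := hθ hr0
      have hΛ : 0 ≤ L / r := div_nonneg hL0 hr0.le
      have hwc : Continuous fun x => θ (r⁻¹ • x) • v := hgc.smul continuous_const
      have hws : HasCompactSupport fun x => θ (r⁻¹ • x) • v := hgs.smul_right
      -- integrability of the pairings
      have hFi : Integrable fun x => θ (r⁻¹ • x) • (u t₂ x - u t₁ x) :=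
        (hgc.smul ((h.continuous_slice ht₂).sub (h.continuous_slice ht₁))).integrable_of_hasCompactSupport
          hgs.smul_right
      have hiB : Integrable fun x => ⟪oseenDuhamel 1 t₁ u u t₂ x, θ (r⁻¹ • x) • v⟫ :=
        integrable_inner_of_norm_le_of_hasCompactSupport
          (aestronglyMeasurable_oseenDuhamel one_pos hmeas hmeas hM0 huM huM ht le_rfl)
          (fun x => hKB one_pos ht hM0 huM huM x) hwc hws
      have hiU1 : Integrable fun x => ⟪u t₁ x, θ (r⁻¹ • x) • v⟫ :=
        integrable_inner_of_continuous_of_hasCompactSupport (h.continuous_slice ht₁) hwc hws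
      have hiU2 : Integrable fun x => ⟪u t₂ x, θ (r⁻¹ • x) • v⟫ :=
        integrable_inner_of_continuous_of_hasCompactSupport (h.continuous_slice ht₂) hwc hws
      have hiH : Integrable fun x => ⟪heatExtension (u t₁) (t₂ - t₁) x, θ (r⁻¹ • x) • v⟫ := by
        refine (hiU2.add hiB).congr (Eventually.of_forall fun x => ?_)
        simp only [Pi.add_apply]
        rw [← inner_add_left, (sub_eq_iff_eq_add.1 (hut x).symm)]
      have hwi : Integrable fun x => θ (r⁻¹ • x) • v := hwc.integrable_of_hasCompactSupport hws
      have hHi : Integrable (heatExtension (fun x => θ (r⁻¹ • x) • v) (t₂ - t₁)) :=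
        memLp_one_iff_integrable.1
          (memLp_heatExtension_holds (memLp_one_iff_integrable.2 hwi) le_rfl hδ)
      have hiE : Integrable fun x => ⟪u t₁ x, heatExtension (fun x => θ (r⁻¹ • x) • v) (t₂ - t₁) x⟫ := by
        refine (hHi.norm.const_mul M₁).mono'
          ((h.aestronglyMeasurable_slice ht₁).inner hHi.aestronglyMeasurable)
          (Eventually.of_forall fun x => ?_)
        exact (norm_inner_le_norm _ _).trans (mul_le_mul_of_nonneg_right (hu₁ x) (norm_nonneg _))
      have hiHU : Integrable fun x => ⟪heatExtension (u t₁) (t₂ - t₁) x, θ (r⁻¹ • x) • v⟫ -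
          ⟪u t₁ x, θ (r⁻¹ • x) • v⟫ := hiH.sub hiU1
      -- the tested identity `⟪v, F r⟫ = I - J`
      have hid : ⟪v, F r⟫ =
          (∫ x, ⟪u t₁ x, heatExtension (fun x => θ (r⁻¹ • x) • v) (t₂ - t₁) x - θ (r⁻¹ • x) • v⟫) -
            ∫ x, ⟪oseenDuhamel 1 t₁ u u t₂ x, θ (r⁻¹ • x) • v⟫ := by
        have hA := integral_inner_heatExtension_comm_of_bound (h.aestronglyMeasurable_slice ht₁)
          hu₁ hwc hws hδ
        calc ⟪v, F r⟫ = ∫ x, ⟪v, θ (r⁻¹ • x) • (u t₂ x - u t₁ x)⟫ := (integral_inner hFi v).symm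
          _ = ∫ x, (⟪heatExtension (u t₁) (t₂ - t₁) x, θ (r⁻¹ • x) • v⟫ -
                ⟪u t₁ x, θ (r⁻¹ • x) • v⟫ - ⟪oseenDuhamel 1 t₁ u u t₂ x, θ (r⁻¹ • x) • v⟫) := by
              refine integral_congr_ae (Eventually.of_forall fun x => ?_)
              beta_reduce
              rw [real_inner_smul_right, real_inner_comm, ← real_inner_smul_right, hut x,
                inner_sub_left, inner_sub_left]
              ring
          _ = (∫ x, ⟪heatExtension (u t₁) (t₂ - t₁) x, θ (r⁻¹ • x) • v⟫) -
                (∫ x, ⟪u t₁ x, θ (r⁻¹ • x) • v⟫) -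
                ∫ x, ⟪oseenDuhamel 1 t₁ u u t₂ x, θ (r⁻¹ • x) • v⟫ := by
              rw [integral_sub hiHU hiB, integral_sub hiH hiU1]
          _ = _ := by
              rw [hA, ← integral_sub hiE hiU1]
              congr 1
              refine integral_congr_ae (Eventually.of_forall fun x => ?_)
              beta_reduce
              rw [inner_sub_right]
      -- volume of the supporting ball
      have hR : 0 < θ.rOut * r := mul_pos θ.rOut_pos hr0
      have hRd : 0 ≤ (θ.rOut * r) ^ d * V₁ := mul_nonneg (pow_nonneg hR.le _) ENNReal.toReal_nonneg
      have hvol : 2 * volume (ball (0 : E) (θ.rOut * r)) =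
          ENNReal.ofReal (2 * ((θ.rOut * r) ^ d * V₁)) := by
        rw [Measure.addHaar_ball_of_pos volume 0 hR, hV₁, ENNReal.ofReal_mul zero_le_two,
          ENNReal.ofReal_mul (pow_nonneg hR.le _), ENNReal.ofReal_toReal measure_ball_lt_top.ne,
          ENNReal.ofReal_ofNat]
      have hb1 : 0 ≤ M₁ * ‖v‖ * (L / r) * m₁ :=
        mul_nonneg (mul_nonneg (mul_nonneg hM₁0 (norm_nonneg _)) hΛ) hm₁0
      have hb2 : 0 ≤ C₁ * M ^ 2 * ‖v‖ * (L / r) ^ (1 / 2 : ℝ) *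
          ((t₂ - t₁) + 2 * Real.sqrt (t₂ - t₁)) :=
        mul_nonneg (mul_nonneg (by positivity) (Real.rpow_nonneg hΛ _)) hδ2
      -- the two bounds
      have hI : ‖∫ x, ⟪u t₁ x, heatExtension (fun x => θ (r⁻¹ • x) • v) (t₂ - t₁) x -
          θ (r⁻¹ • x) • v⟫‖ ≤ M₁ * ‖v‖ * (L / r) * m₁ * (2 * ((θ.rOut * r) ^ d * V₁)) := by
        have h1 := fpl_meanDisp_caloric_le hM₁0 hu₁ hgc hgB hΛ hgL hg1 v hδ
        rw [hvol, ← ENNReal.ofReal_mul hb1, ← ofReal_norm,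
          ENNReal.ofReal_le_ofReal_iff (mul_nonneg hb1 (mul_nonneg zero_le_two hRd))] at h1
        exact h1
      have hJr : ‖∫ x, ⟪oseenDuhamel 1 t₁ u u t₂ x, θ (r⁻¹ • x) • v⟫‖ ≤
          C₁ * M ^ 2 * ‖v‖ * (L / r) ^ (1 / 2 : ℝ) * ((t₂ - t₁) + 2 * Real.sqrt (t₂ - t₁)) *
            (2 * ((θ.rOut * r) ^ d * V₁)) := by
        have h1 := hJ h ht ht₂ hgc hgs hgB hΛ hg1 hgmin v
        rw [hvol, ← ENNReal.ofReal_mul hb2, ← ofReal_norm,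
          ENNReal.ofReal_le_ofReal_iff (mul_nonneg hb2 (mul_nonneg zero_le_two hRd))] at h1
        exact h1
      -- algebra
      have hrd : (r ^ d : ℝ) ≠ 0 := pow_ne_zero _ hr0.ne'
      have hLr : (L / r) ^ (1 / 2 : ℝ) = L ^ (1 / 2 : ℝ) * r ^ (-(1 / 2 : ℝ)) := by
        rw [Real.div_rpow hL0 hr0.le, Real.rpow_neg hr0.le, div_eq_mul_inv]
      rw [norm_mul, norm_inv, norm_pow, Real.norm_of_nonneg hr0.le, hid]
      calc (r ^ d)⁻¹ * ‖(∫ x, ⟪u t₁ x, heatExtension (fun x => θ (r⁻¹ • x) • v) (t₂ - t₁) x -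
              θ (r⁻¹ • x) • v⟫) - ∫ x, ⟪oseenDuhamel 1 t₁ u u t₂ x, θ (r⁻¹ • x) • v⟫‖
          ≤ (r ^ d)⁻¹ * (M₁ * ‖v‖ * (L / r) * m₁ * (2 * ((θ.rOut * r) ^ d * V₁)) +
              C₁ * M ^ 2 * ‖v‖ * (L / r) ^ (1 / 2 : ℝ) * ((t₂ - t₁) + 2 * Real.sqrt (t₂ - t₁)) *
                (2 * ((θ.rOut * r) ^ d * V₁))) := by
            gcongr
            exact (norm_sub_le _ _).trans (add_le_add hI hJr)
        _ = ‖v‖ * (K₁ * r⁻¹ + K₂ * r ^ (-(1 / 2 : ℝ))) := by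
            rw [hLr, hK₁, hK₂, mul_pow]
            field_simp
    -- squeeze
    have hlim : Tendsto (fun r : ℝ => ‖v‖ * (K₁ * r⁻¹ + K₂ * r ^ (-(1 / 2 : ℝ)))) atTop (𝓝 0) := by
      have h1 : Tendsto (fun r : ℝ => K₁ * r⁻¹) atTop (𝓝 0) := by
        simpa using tendsto_inv_atTop_zero.const_mul K₁
      have h2 : Tendsto (fun r : ℝ => K₂ * r ^ (-(1 / 2 : ℝ))) atTop (𝓝 0) := by
        simpa using (tendsto_rpow_neg_atTop (by norm_num : (0 : ℝ) < 1 / 2)).const_mul K₂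
      simpa using (h1.add h2).const_mul ‖v‖
    refine squeeze_zero_norm' ?_ hlim
    filter_upwards [eventually_gt_atTop 0] with r hr using hbound r hr
  -- conclude in an orthonormal basis
  set b := stdOrthonormalBasis ℝ E with hb
  have hrepr : ∀ r : ℝ, (r ^ d)⁻¹ • F r = ∑ i, ((r ^ d)⁻¹ * ⟪b i, F r⟫) • b i := fun r => by
    conv_lhs => rw [← b.sum_repr' (F r)]
    rw [Finset.smul_sum]
    simp only [smul_smul]
  show Tendsto (fun r : ℝ => (r ^ d)⁻¹ • F r) atTop (𝓝 0)
  simp_rw [hrepr]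
  rw [show (0 : E) = ∑ i, (0 : ℝ) • b i by simp]
  exact tendsto_finsetSum _ fun i _ => (key (b i)).smul_const (b i)

/-- **Registered stub MD of line `uloc-gronwall-transplant`** (crux stmt-NavierStokesRegularity-14060,
`SymmetryModuliCount.FarPastLedger`): for `u ∈ A_C` (`IsTypeIAncientMild C u`), `t₁ < t₂ < 0` and
the Mathlib bump `θ` at the origin of `ℝ³` (`= 1` on `B̄₁`, supported in `B₂`), the bump-averaged
displacement `r⁻³ ∫ θ(x/r) (u(t₂,x) − u(t₁,x)) dx` tends to `0` as `r → ∞` — the one place where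
the Oseen integral identity (H3) of the class is consumed (for the parasitic non-mild fields
`b(t)` the statement fails). Specialisation of `fpl_meanDisp_tendsto` to `dim ℝ³ = 3`. [cite: KochNadirashviliSereginSverak2009, §4 p. 8 and §6 p. 11 (arXiv:0709.3599)] -/
theorem stub_fplMeanDisplacement :
    ∀ (C : ℝ) (u : ℝ → EuclideanSpace ℝ (Fin 3) → EuclideanSpace ℝ (Fin 3)),
    Literature.Analysis.FluidPDE.IsTypeIAncientMild C u →
    ∀ t₁ t₂ : ℝ, t₁ < t₂ → t₂ < 0 →
    Filter.Tendsto (fun r : ℝ => (r ^ 3)⁻¹ •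
      ∫ x, (((⟨1, 2, zero_lt_one, one_lt_two⟩ : ContDiffBump (0 : EuclideanSpace ℝ (Fin 3))) :
          EuclideanSpace ℝ (Fin 3) → ℝ) (r⁻¹ • x)) • (u t₂ x - u t₁ x))
      Filter.atTop (nhds 0) := by
  intro C u hu t₁ t₂ ht ht₂
  have h := fpl_meanDisp_tendsto hu
    (⟨1, 2, zero_lt_one, one_lt_two⟩ : ContDiffBump (0 : EuclideanSpace ℝ (Fin 3))) ht ht₂
  rwa [finrank_euclideanSpace_fin] at h

end Summit.NavierStokesRegularity.NavierStokesRegularity.Theorems
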